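import Summits.Ventures.AbcSig.Rows.TemplateAB
import Summits.Ventures.AbcSig.Levels.N179
import Summits.Ventures.AbcSig.Levels.N358

/-!
# Venture AbcSig — ROW `C2aL179A6AB`: `179^m·xⁿ + 2^a·yⁿ = z²` (SECOND coefficient distribution of the cell; the distribution `xⁿ + 2^a·179^m·yⁿ = z²` is `Rows/C2aL179A6.lean`), class `a ge6` (GENERATED by plean/leanrow.py)

HONEST FRAMING. A row of a COMPUTATION cell (`pub-abcsig`); a CONDITIONAL theorem, no claim on ABC or any summit.
Hypotheses: `BS04Package` (CITED), `DataComplete` at levels [179, 358] (COMPUTED, two-engine certified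
level files), and the listed per-orbit exclusions `hX_…` (CITED — e.g. the cell's M6 Eisenstein certificates; the
row's R5 cell names each). Everything else is kernel-checked (`Rows/TemplateAB.lean`, `Levels/N….lean` — the SAME level files as the first distribution). Exponent
range: prime `n ≥ 11`, `n ≠ 179`, n ∉ [11, 17, 89]; `B = 2^a 179^m` with `a, m < n` (n-th-power free).

-/

namespace Summit.Ventures.AbcSig

/-- Row `C2aL179A6AB`: second coefficient distribution `179^m·xⁿ + 2^a·yⁿ = z²` (see module docstring). -/
theorem row_C2aL179A6AB (M : NewformModel) (hP : M.BS04Package)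
    (hD179 : M.DataComplete 179 level179Orbits) (hD358 : M.DataComplete 358 level358Orbits)
    (n : ℕ) (hn : n.Prime) (hmin : 11 ≤ n) (hnℓ : n ≠ 179) (hres : n ∉ ([11, 17, 89] : List ℕ)) (a m : ℕ) (ha : 6 ≤ a) (hm : 1 ≤ m) (han : a < n) (hmn : m < n)
    
    (x y z : ℤ) (hxy1 : x * y ≠ 1) (hxy2 : x * y ≠ -1) : ¬ IsPrimitiveSolution (179 ^ m) (2 ^ a) 1 n x y z := by
  have hℓ : Nat.Prime 179 := by norm_num
  have h7 : 7 ≤ n := by omega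
  have hS179 :=
    (level179_sieve n hn h7 (fun o => M.Excludes 179 o (famAB (179 ^ m) (2 ^ a) n (fun _ _ => True))) (fun h => absurd h (by simp only [List.mem_cons, List.not_mem_nil, or_false] at hres ⊢; omega)) (fun h => absurd h (by simp only [List.mem_cons, List.not_mem_nil, or_false] at hres ⊢; omega)) (fun h => absurd h (by simp only [List.mem_cons, List.not_mem_nil, or_false] at hres ⊢; omega)))
  have hS358 :=
    (level358_sieve n hn h7 (fun o => M.Excludes 358 o (famAB (179 ^ m) (2 ^ a) n (fun _ _ => True))) (fun h => absurd h (by simp only [List.mem_cons, List.not_mem_nil, or_false] at hres ⊢; omega)) (fun h => absurd h (by simp only [List.mem_cons, List.not_mem_nil, or_false] at hres ⊢; omega)) (fun h => absurd h (by simp only [List.mem_cons, List.not_mem_nil, or_false] at hres ⊢; omega)) (fun h => absurd h (by simp only [List.mem_cons, List.not_mem_nil, or_false] at hres ⊢; omega)) (fun h => absurd h (by simp only [List.mem_cons, List.not_mem_nil, or_false] at hres ⊢; omega)))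
  by_cases ha6 : a = 6
  · subst ha6
    exact rowC2aAB_a6 179 hℓ (by norm_num) M hP n hn h7 hnℓ hD179 hD358 m hm hmn
      hS179
      hS358 x y z hxy1 hxy2
  · exact rowC2aAB_age7 179 hℓ (by norm_num) M hP n hn h7 hnℓ hD358 a m (by omega) hm han hmn
      hS358 x y z hxy1 hxy2

end Summit.Ventures.AbcSig
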